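import Summits.HodgeConjecture.CorCM.GaloisSixteenTableLawsA
import HarnessLib

/-!
# Structure of the groups of order `16` with a central involution, I: an element of order `8`; all squares in
# `{1, c}`

COR-CM (cell `pub-hodgecm2`), binder seat b04 (gen 17), count-neutral claim GALOIS16-COMPLETE.  KERNEL ONLY:
theorems; no definition, no named fact, no `sorry`.  `HC_CM` is neither used nor claimed.  Pure, classification-free
group theory: a finite group `G` with `|G| = 16` and a central involution `c` (for a Galois CM field of degree `16`:
`Gal(K/ℚ)` and complex conjugation).

* §1 words: `exists_pow_lt_of_mem_zpowers`; `mem_or_mul_inv_mem` (index `2`); `orderOf_eq_four`.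
* §2 **`structure_of_orderOf_eq_eight`** — an element `r` of order `8` and `s ∉ ⟨r⟩`: every element is `rⁱ` or
  `rⁱ s`, and `s r = r^μ s`, `s² = r^τ` with `μ` odd and `μ τ ≡ τ (mod 8)` (law A of `GaloisSixteenTableLawsA`);
  `comm_of_orderOf_eq_eight` — if moreover `s r = r s` the group is commutative.
* §3 **`structure_of_sq_subset`** — all squares in `{1, c}` and two non-commuting elements: generators `x, y, t`
  with `x² = c`, `y x = x³ y`, `y² ∈ {1, x²}`, `t` commuting with `x, y`, `t² ∈ {1, x²}`, `y ∉ ⟨x⟩`, `xⁱ yʲ t ≠ 1`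
  (law C of `GaloisSixteenTableLawsB`: `D₄ × C₂`, `Q₈ × C₂`, `C₄ ∘ D₄`, each with `c` in the square class).

Part II (`GaloisSixteenStructureB`) treats exponent `4` with a square outside `{1, c}` (law E).

## References

* [Dodson1984] B. Dodson, *The structure of Galois groups of CM-fields*, Trans. AMS 283 (1984), §5.2, §5.3.1.
* [Shimura1998] G. Shimura, *Abelian Varieties with Complex Multiplication and Modular Functions*, §8.1.
-/

namespace Summit.HodgeConjecture.CorCM.GaloisSixteenStructure

open Summit.HodgeConjecture.CorCM.GaloisTableLaws

variable {G : Type*} [Group G]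

/-! ## §1 Words -/

/-- An element of `⟨r⟩` is `rⁱ` with `i < orderOf r` (finite group). [folklore] -/
theorem exists_pow_lt_of_mem_zpowers [Finite G] {r u : G} (hu : u ∈ Subgroup.zpowers r) :
    ∃ i : ℕ, i < orderOf r ∧ u = r ^ i := by
  rw [← mem_powers_iff_mem_zpowers, Submonoid.mem_powers_iff] at hu
  obtain ⟨m, rfl⟩ := hu
  exact ⟨m % orderOf r, Nat.mod_lt _ (orderOf_pos r), (pow_mod_orderOf r m).symm⟩

/-- For a subgroup of index `2` and `s ∉ H`: every `u` lies in `H` or in `H s`. [folklore] -/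
theorem mem_or_mul_inv_mem {H : Subgroup G} (hH : H.index = 2) {s : G} (hs : s ∉ H) (u : G) :
    u ∈ H ∨ u * s⁻¹ ∈ H := by
  by_cases hu : u ∈ H
  · exact Or.inl hu
  · right
    rw [Subgroup.mul_mem_iff_of_index_two hH]
    exact iff_of_false hu (fun h => hs (by simpa using h))

/-- `orderOf x = 4` from `x⁴ = 1`, `x ≠ 1`, `x² ≠ 1`. [folklore] -/
theorem orderOf_eq_four {x : G} (h4 : x ^ 4 = 1) (h1 : x ≠ 1) (h2 : x * x ≠ 1) : orderOf x = 4 := by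
  rw [orderOf_eq_iff (by norm_num)]
  refine ⟨h4, fun m hm hm0 hxm => ?_⟩
  interval_cases m
  · exact h1 (by simpa using hxm)
  · exact h2 (by simpa [pow_two] using hxm)
  · apply h1
    have h : x ^ 4 = x ^ 3 * x := pow_succ x 3
    rw [hxm, one_mul, h4] at h
    exact h.symm

/-! ## §2 An element of order `8` -/

/-- **Normal form with an element of order `8`.**  `|G| = 16`, `r` of order `8`, `s ∉ ⟨r⟩`: every element is `rⁱ`
or `rⁱ s` (`i < 8`), and `s r = r^μ s`, `s s = r^τ` with `μ, τ < 8`, `μ` odd and `μ τ ≡ τ (mod 8)`. [folklore] -/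
theorem structure_of_orderOf_eq_eight [Finite G] (hcard : Nat.card G = 16) (r s : G) (hr : orderOf r = 8)
    (hs : s ∉ Subgroup.zpowers r) :
    (∀ u : G, ∃ i : ℕ, i < 8 ∧ (u = r ^ i ∨ u = r ^ i * s)) ∧
    ∃ μ τ : ℕ, μ < 8 ∧ τ < 8 ∧ s * r = r ^ μ * s ∧ s * s = r ^ τ ∧ μ % 2 = 1 ∧ (μ * τ) % 8 = τ := by
  set H := Subgroup.zpowers r with hH
  have hHcard : Nat.card H = 8 := by rw [hH, Nat.card_zpowers, hr]
  have hidx : H.index = 2 := by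
    have h := H.index_mul_card
    rw [hHcard, hcard] at h
    omega
  have hr8 : r ^ 8 = 1 := by rw [← hr]; exact pow_orderOf_eq_one r
  have hwords : ∀ u : G, ∃ i : ℕ, i < 8 ∧ (u = r ^ i ∨ u = r ^ i * s) := by
    intro u
    rcases mem_or_mul_inv_mem hidx hs u with hu | hu
    · obtain ⟨i, hi, rfl⟩ := exists_pow_lt_of_mem_zpowers hu
      exact ⟨i, hr ▸ hi, Or.inl rfl⟩
    · obtain ⟨i, hi, hui⟩ := exists_pow_lt_of_mem_zpowers hu
      refine ⟨i, hr ▸ hi, Or.inr ?_⟩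
      rw [← hui, inv_mul_cancel_right]
  have hpow_mem : ∀ i : ℕ, r ^ i ∈ H := fun i => H.pow_mem (Subgroup.mem_zpowers r) i
  refine ⟨hwords, ?_⟩
  -- `s r = r^μ s`
  obtain ⟨μ, hμ, hsr⟩ : ∃ μ : ℕ, μ < 8 ∧ s * r = r ^ μ * s := by
    obtain ⟨i, hi, h | h⟩ := hwords (s * r)
    · exfalso
      apply hs
      have h' : s = r ^ i * r⁻¹ := by rw [← h, mul_inv_cancel_right]
      rw [h']
      exact H.mul_mem (hpow_mem i) (H.inv_mem (Subgroup.mem_zpowers r))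
    · exact ⟨i, hi, h⟩
  -- `s s = r^τ`
  obtain ⟨τ, hτ, hss⟩ : ∃ τ : ℕ, τ < 8 ∧ s * s = r ^ τ := by
    obtain ⟨i, hi, h | h⟩ := hwords (s * s)
    · exact ⟨i, hi, h⟩
    · exfalso
      apply hs
      rw [mul_right_cancel h]
      exact hpow_mem i
  refine ⟨μ, τ, hμ, hτ, hsr, hss, ?_, ?_⟩
  · -- `μ` is odd: otherwise `s r⁴ s⁻¹ = r^{4μ} = 1`
    by_contra hodd
    have h4 : s * r ^ 4 = r ^ (μ * 4) * s := s_mul_pow r s μ hsr 4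
    have hμ4 : r ^ (μ * 4) = 1 := by
      rw [pow_eq_pow_of_mod_eq r hr8 (a := μ * 4) (b := 0) (by omega), pow_zero]
    rw [hμ4, one_mul] at h4
    have h1 : r ^ 4 = 1 := mul_left_cancel (a := s) (by rw [h4, mul_one])
    have h2 := orderOf_dvd_of_pow_eq_one h1
    rw [hr] at h2
    omega
  · -- `s` commutes with `s² = r^τ`: `r^{μ τ} s = s r^τ = r^τ s`
    have h1 : s * r ^ τ = r ^ (μ * τ) * s := s_mul_pow r s μ hsr τ
    have h2 : s * r ^ τ = r ^ τ * s := by rw [← hss, mul_assoc]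
    rw [h2] at h1
    have h3 : r ^ τ = r ^ (μ * τ) := mul_right_cancel h1
    rw [pow_inj_mod, hr] at h3
    omega

/-- If `s r = r s` in the situation of `structure_of_orderOf_eq_eight`, the group is commutative. [folklore] -/
theorem comm_of_orderOf_eq_eight [Finite G] (hcard : Nat.card G = 16) (r s : G) (hr : orderOf r = 8)
    (hs : s ∉ Subgroup.zpowers r) (hsr : s * r = r * s) (u v : G) : u * v = v * u := by
  obtain ⟨hwords, -⟩ := structure_of_orderOf_eq_eight hcard r s hr hs
  have hc : Commute r s := hsr.symm
  have key : ∀ u : G, Commute r u ∧ Commute s u := by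
    intro u
    obtain ⟨i, -, rfl | rfl⟩ := hwords u
    · exact ⟨Commute.pow_right (Commute.refl r) i, Commute.pow_right hc.symm i⟩
    · exact ⟨Commute.mul_right (Commute.pow_right (Commute.refl r) i) hc,
        Commute.mul_right (Commute.pow_right hc.symm i) (Commute.refl s)⟩
  obtain ⟨i, -, rfl | rfl⟩ := hwords u
  · exact (Commute.pow_left (key v).1 i).eq
  · exact (Commute.mul_left (Commute.pow_left (key v).1 i) (key v).2).eq

/-! ## §3 All squares in `{1, c}` -/

/-- `c² = 1` if all squares lie in `{1, c}` and `c ≠ 1`. [folklore] -/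
theorem sq_c_eq_one (c : G) (hc1 : c ≠ 1) (hsq : ∀ g : G, g * g = 1 ∨ g * g = c) : c * c = 1 := by
  rcases hsq c with h | h
  · exact h
  · exact absurd (mul_left_cancel (a := c) (h.trans (mul_one c).symm)) hc1

/-- Every square is `cᵃ` with `a ∈ {0, 1}`. [folklore] -/
theorem exists_sq_eq_pow (c : G) (hsq : ∀ g : G, g * g = 1 ∨ g * g = c) (u : G) :
    ∃ a : ℕ, a < 2 ∧ u * u = c ^ a := by
  rcases hsq u with h | h
  · exact ⟨0, by norm_num, by rw [h, pow_zero]⟩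
  · exact ⟨1, by norm_num, by rw [h, pow_one]⟩

/-- **The commutator relation**: `v u = u v cⁿ` for some `n` (all squares in `{1, c}`, `c` central). [folklore] -/
theorem exists_comm_rel (c : G) (hc1 : c ≠ 1) (hcz : ∀ g : G, g * c = c * g)
    (hsq : ∀ g : G, g * g = 1 ∨ g * g = c) (u v : G) : ∃ n : ℕ, v * u = u * v * c ^ n := by
  have hcc := sq_c_eq_one c hc1 hsq
  have hcpow : ∀ (n : ℕ) (g : G), c ^ n * g = g * c ^ n := fun n g => (Commute.pow_right (hcz g) n).eq.symm
  obtain ⟨a, -, ha⟩ := exists_sq_eq_pow c hsq u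
  obtain ⟨d, -, hd⟩ := exists_sq_eq_pow c hsq v
  obtain ⟨e, -, he⟩ := exists_sq_eq_pow c hsq (u * v)
  have hc2 : ∀ n : ℕ, c ^ n * c ^ n = 1 := fun n => by
    rw [← pow_add, pow_eq_pow_of_mod_eq c (n := 2) (by rw [pow_two, hcc]) (a := n + n) (b := 0) (by omega),
      pow_zero]
  have hu : u⁻¹ = u * c ^ a := inv_eq_of_mul_eq_one_right (by rw [← mul_assoc, ha, hc2])
  have hv : v⁻¹ = v * c ^ d := inv_eq_of_mul_eq_one_right (by rw [← mul_assoc, hd, hc2])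
  have key : v * u = u⁻¹ * ((u * v) * (u * v)) * v⁻¹ := by group
  refine ⟨a + e + d, ?_⟩
  rw [key, he, hu, hv]
  calc u * c ^ a * c ^ e * (v * c ^ d) = u * (c ^ (a + e) * v) * c ^ d := by rw [pow_add]; simp only [mul_assoc]
    _ = u * (v * c ^ (a + e)) * c ^ d := by rw [hcpow]
    _ = u * v * c ^ (a + e + d) := by rw [pow_add c (a + e) d]; simp only [mul_assoc]

/-- Either `v u = u v` or `v u = u v c`. [folklore] -/
theorem comm_or (c : G) (hc1 : c ≠ 1) (hcz : ∀ g : G, g * c = c * g) (hsq : ∀ g : G, g * g = 1 ∨ g * g = c)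
    (u v : G) : v * u = u * v ∨ v * u = u * v * c := by
  have hcc := sq_c_eq_one c hc1 hsq
  obtain ⟨n, hn⟩ := exists_comm_rel c hc1 hcz hsq u v
  rw [← pow_eq_pow_of_mod_eq c (n := 2) (by rw [pow_two, hcc]) (Nat.mod_mod n 2)] at hn
  rcases Nat.mod_two_eq_zero_or_one n with h | h <;> rw [h] at hn
  · left; rw [hn, pow_zero, mul_one]
  · right; rw [hn, pow_one]

/-- **Normal form when all squares lie in `{1, c}`** (`c ≠ 1` central) and `G` is non-commutative of order `16`:
generators `x, y, t` with `x` of order `4`, `x² = c`, `y ∉ ⟨x⟩`, `y x = x³ y`, `y² ∈ {1, x²}`, `t` commuting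
with `x` and `y`, `t² ∈ {1, x²}`, and `xⁱ yʲ t ≠ 1` for all `i, j` — the hypotheses of `exists_table_lawC`.
[folklore] -/
theorem structure_of_sq_subset [Finite G] (hcard : Nat.card G = 16) (c : G) (hc1 : c ≠ 1)
    (hcz : ∀ g : G, g * c = c * g) (hsq : ∀ g : G, g * g = 1 ∨ g * g = c) (a b : G) (hab : a * b ≠ b * a) :
    ∃ x y t : G, orderOf x = 4 ∧ x * x = c ∧ y ∉ Subgroup.zpowers x ∧ (∀ i j : ℕ, x ^ i * y ^ j * t ≠ 1) ∧
      y * x = x ^ 3 * y ∧ (y * y = 1 ∨ y * y = x ^ 2) ∧ t * x = x * t ∧ t * y = y * t ∧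
      (t * t = 1 ∨ t * t = x ^ 2) := by
  have hcc := sq_c_eq_one c hc1 hsq
  have h4 : ∀ g : G, g ^ 4 = 1 := fun g => by
    rw [show (4 : ℕ) = 2 + 2 by norm_num, pow_add, pow_two]
    rcases hsq g with h | h <;> rw [h]
    · exact one_mul 1
    · exact hcc
  -- Step 1: `x` with `x² = c` and `y` with `y x = x y c`
  obtain ⟨x, y, hxx, hyx⟩ : ∃ x y : G, x * x = c ∧ y * x = x * y * c := by
    have hba : a * b = b * a * c := (comm_or c hc1 hcz hsq b a).resolve_left hab
    have hab' : b * a = a * b * c := by rw [hba, mul_assoc, mul_assoc, hcc, mul_one]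
    rcases hsq a with ha | ha
    · rcases hsq b with hb | hb
      · -- `x = a b`, `y = b`
        refine ⟨a * b, b, ?_, ?_⟩
        · calc a * b * (a * b) = a * (b * a) * b := by group
            _ = a * (a * b * c) * b := by rw [hab']
            _ = a * a * (b * (c * b)) := by group
            _ = c := by rw [ha, one_mul, ← hcz b, ← mul_assoc, hb, one_mul]
        · calc b * (a * b) = b * a * b := by group
            _ = a * b * c * b := by rw [hab']
            _ = a * b * (c * b) := by group
            _ = a * b * b * c := by rw [← hcz b]; group
      · exact ⟨b, a, hb, hba⟩
    · exact ⟨a, b, ha, hab'⟩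
  -- Step 2: facts about `x`, `y`
  have hx1 : x ≠ 1 := fun h => hc1 (by rw [← hxx, h, one_mul])
  have hx2 : x * x ≠ 1 := fun h => hc1 (hxx ▸ h)
  have hx : orderOf x = 4 := orderOf_eq_four (h4 x) hx1 hx2
  have hxsq : x ^ 2 = c := by rw [pow_two, hxx]
  have hyx3 : y * x = x ^ 3 * y := by
    calc y * x = x * y * c := hyx
      _ = x * (y * c) := mul_assoc _ _ _
      _ = x * (c * y) := by rw [hcz y]
      _ = x * (x * x * y) := by rw [hxx]
      _ = x ^ 3 * y := by rw [pow_succ, pow_two]; simp only [mul_assoc]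
  have hxy : x * y = y * x * c := by
    calc x * y = x * y * (c * c) := by rw [hcc, mul_one]
      _ = (x * y * c) * c := by group
      _ = y * x * c := by rw [← hyx]
  have hy : y ∉ Subgroup.zpowers x := by
    intro hmem
    obtain ⟨k, -, rfl⟩ := exists_pow_lt_of_mem_zpowers hmem
    have h1 : x ^ k * x = x * x ^ k := (Commute.pow_left (Commute.refl x) k).eq
    rw [h1] at hyx
    exact hc1 (mul_left_cancel (hyx.symm.trans (mul_one _).symm))
  have hysq : y * y = 1 ∨ y * y = x ^ 2 := by rw [hxsq]; exact hsq y
  -- Step 3: the words of `H = ⟨x, y⟩`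
  have hword_mul : ∀ i j i' j' : ℕ, (x ^ i * y ^ j) * (x ^ i' * y ^ j') = x ^ (i + 3 ^ j * i') * y ^ (j + j') := by
    intro i j i' j'
    rw [mul_assoc, ← mul_assoc (y ^ j), pow_mul_pow_of_yx x y hyx3 j i', mul_assoc, ← pow_add, ← mul_assoc,
      ← pow_add]
  set H := Subgroup.closure ({x, y} : Set G) with hH_def
  have hmemx : x ∈ H := Subgroup.subset_closure (by simp)
  have hmemy : y ∈ H := Subgroup.subset_closure (by simp)
  have hH : ∀ g ∈ H, ∃ i j : ℕ, g = x ^ i * y ^ j := by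
    intro g hg
    induction hg using Subgroup.closure_induction with
    | mem z hz =>
      simp only [Set.mem_insert_iff, Set.mem_singleton_iff] at hz
      rcases hz with rfl | rfl
      · exact ⟨1, 0, by simp⟩
      · exact ⟨0, 1, by simp⟩
    | one => exact ⟨0, 0, by simp⟩
    | mul u v _ _ ihu ihv =>
      obtain ⟨i, j, rfl⟩ := ihu
      obtain ⟨i', j', rfl⟩ := ihv
      exact ⟨_, _, hword_mul i j i' j'⟩
    | inv u _ ihu =>
      obtain ⟨i, j, rfl⟩ := ihu
      have hinv : (x ^ i * y ^ j)⁻¹ = (x ^ i * y ^ j) ^ 3 :=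
        inv_eq_of_mul_eq_one_right (by rw [← pow_succ', h4])
      rw [hinv, pow_succ, pow_two, hword_mul, hword_mul]
      exact ⟨_, _, rfl⟩
  have hreduce : ∀ i j : ℕ, ∃ i' j' : ℕ, i' < 4 ∧ j' < 2 ∧ x ^ i * y ^ j = x ^ i' * y ^ j' := by
    intro i j
    have hj : y ^ j = (y * y) ^ (j / 2) * y ^ (j % 2) := by
      conv_lhs => rw [← Nat.div_add_mod j 2]
      rw [pow_add, pow_mul, pow_two]
    rcases hysq with h | h
    · refine ⟨i % 4, j % 2, Nat.mod_lt _ (by norm_num), Nat.mod_lt _ (by norm_num), ?_⟩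
      rw [hj, h, one_pow, one_mul, ← hx, pow_mod_orderOf]
    · refine ⟨(i + 2 * (j / 2)) % 4, j % 2, Nat.mod_lt _ (by norm_num), Nat.mod_lt _ (by norm_num), ?_⟩
      rw [hj, h, ← pow_mul, ← mul_assoc, ← pow_add, ← hx, pow_mod_orderOf]
  have hHle : Nat.card H ≤ 8 := by
    have hsurj : Function.Surjective (fun p : Fin 4 × Fin 2 =>
        (⟨x ^ (p.1 : ℕ) * y ^ (p.2 : ℕ), H.mul_mem (H.pow_mem hmemx _) (H.pow_mem hmemy _)⟩ : H)) := by
      rintro ⟨h, hh⟩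
      obtain ⟨i, j, rfl⟩ := hH h hh
      obtain ⟨i', j', hi', hj', heq⟩ := hreduce i j
      exact ⟨(⟨i', hi'⟩, ⟨j', hj'⟩), Subtype.ext heq.symm⟩
    have h := Nat.card_le_card_of_surjective _ hsurj
    simpa using h
  -- an element outside `H`
  obtain ⟨g, hg⟩ : ∃ g : G, g ∉ H := by
    by_contra hall
    simp only [not_exists, not_not] at hall
    have hHtop : H = ⊤ := (Subgroup.eq_top_iff' H).2 hall
    have h16 : Nat.card H = 16 := by rw [hHtop, Subgroup.card_top, hcard]
    omega
  -- Step 4: adjust `g` to commute with `y`, then with `x`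
  obtain ⟨t₁, ht₁H, ht₁y⟩ : ∃ t₁ : G, t₁ ∉ H ∧ t₁ * y = y * t₁ := by
    rcases comm_or c hc1 hcz hsq y g with h | h
    · exact ⟨g, hg, h⟩
    · refine ⟨g * x, fun hmem => hg ?_, ?_⟩
      · simpa using H.mul_mem hmem (H.inv_mem hmemx)
      · calc g * x * y = g * (x * y) := mul_assoc _ _ _
          _ = g * (y * x * c) := by rw [hxy]
          _ = (g * y) * (x * c) := by group
          _ = (y * g * c) * (x * c) := by rw [h]
          _ = y * g * (c * x) * c := by group
          _ = y * g * (x * c) * c := by rw [← hcz x]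
          _ = y * (g * x) * (c * c) := by group
          _ = y * (g * x) := by rw [hcc, mul_one]
  obtain ⟨t, htH, hty, htx⟩ : ∃ t : G, t ∉ H ∧ t * y = y * t ∧ t * x = x * t := by
    rcases comm_or c hc1 hcz hsq x t₁ with h | h
    · exact ⟨t₁, ht₁H, ht₁y, h⟩
    · refine ⟨t₁ * y, fun hmem => ht₁H ?_, ?_, ?_⟩
      · simpa using H.mul_mem hmem (H.inv_mem hmemy)
      · rw [← mul_assoc, ← ht₁y]
      · calc t₁ * y * x = t₁ * (y * x) := mul_assoc _ _ _
          _ = t₁ * (x * y * c) := by rw [hyx]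
          _ = (t₁ * x) * (y * c) := by group
          _ = (x * t₁ * c) * (y * c) := by rw [h]
          _ = x * t₁ * (c * y) * c := by group
          _ = x * t₁ * (y * c) * c := by rw [← hcz y]
          _ = x * (t₁ * y) * (c * c) := by group
          _ = x * (t₁ * y) := by rw [hcc, mul_one]
  -- conclusion
  refine ⟨x, y, t, hx, hxx, hy, fun i j h => htH ?_, hyx3, hysq, htx, hty, ?_⟩
  · rw [eq_inv_of_mul_eq_one_right h]
    exact H.inv_mem (H.mul_mem (H.pow_mem hmemx i) (H.pow_mem hmemy j))
  · rw [hxsq]; exact hsq t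

end Summit.HodgeConjecture.CorCM.GaloisSixteenStructure
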